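import Mathlib
import Literature.Computability.AlgebraicComplexity.LinSubst

/-!
# Border apolarity, crux `ToricWitnessObstructionQP` — stub `stub_eigenCompletion` (S4, eigen-completion)

Route `ValiantsHypothesis/BorderApolarity`, crux item `stmt-ValiantsHypothesis-14753`, line `Sketch`,
stub `stub_eigenCompletion`.  Pure linear algebra over `ℂ`: for `u ∈ GL σ ℂ`, a weight `w : σ → ℕ`
and a set `U` of coordinates such that the columns `i ∈ U` of `N := u · diag(w) · u⁻¹` are
multiples of the coordinate vectors `e_i`, there is `p ∈ GL σ ℂ` whose columns indexed by `U` are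
the coordinate vectors and which conjugates the one-parameter torus `s ↦ u · diag(s ^ w) · u⁻¹`
onto a coordinate torus `diag(s ^ w')`, with `w'_i = N_ii` on `U`.

Proof.  Put `f_i := u⁻¹ e_i` (column `i` of `u⁻¹`).  The hypothesis says `diag(w) f_i = N_ii f_i`,
so `f_i` is supported on a level set `{k | w k = v_i}` with `(v_i : ℂ) = N_ii`.  Extend the
independent family `(f_i)_{i ∈ U}` by coordinate vectors to a basis of `ℂ^σ` (exchange lemma,
`exists_linearIndepOn_extension`); the resulting invertible matrix `q` (columns `f_i` on `U`,
coordinate vectors `e_{g i}` off `U`) has every column supported on a single level set of `w`, hence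
`diag(s ^ w) q = q diag(s ^ w')` for `w' := v` on `U` and `w' := w ∘ g` off `U`; then `p := u q`
works: its `U`-columns are `u u⁻¹ e_i = e_i` and `p⁻¹ u diag(s^w) u⁻¹ p = q⁻¹ diag(s^w) q =
diag(s^{w'})`.
-/

open MvPolynomial
open scoped BigOperators Matrix
open Literature.Computability.AlgebraicComplexity

-- the mandated summit-side namespace repeats a component by design (single-problem summit)
set_option linter.dupNamespace false

namespace Summit.ValiantsHypothesis.ValiantsHypothesis.Theorems.BorderApolarityToricWitnessObstructionQP

/-- **Completing prescribed columns of an invertible matrix by coordinate vectors.**  For an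
invertible matrix `B` and a set `U` of column indices there is an invertible matrix `q` whose
columns indexed by `U` are those of `B` and whose remaining columns are coordinate vectors
`e_{g i}` (Steinitz exchange: extend the independent columns `(B e_i)_{i ∈ U}` by standard basis
vectors to a basis). [folklore] -/
theorem exists_isUnit_extend_cols {K σ : Type*} [Field K] [Fintype σ] [DecidableEq σ]
    (B : Matrix σ σ K) (hB : IsUnit B) (U : Finset σ) :
    ∃ (q : Matrix σ σ K) (g : σ → σ), IsUnit q ∧ (∀ i ∈ U, ∀ j, q j i = B j i) ∧
      (∀ i, i ∉ U → ∀ j, q j i = (Pi.single (g i) 1 : σ → K) j) := by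
  classical
  -- candidate vectors: the columns of `B` (left summand) and the coordinate vectors (right summand)
  let v : σ ⊕ σ → σ → K := Sum.elim B.col fun k => Pi.single k 1
  -- the columns of `B` indexed by `U` are linearly independent
  have hs : LinearIndepOn K v (Sum.inl '' (U : Set σ)) := by
    have h1 : LinearIndependent K (v ∘ Sum.inl) := Matrix.linearIndependent_cols_iff_isUnit.2 hB
    exact ((linearIndepOn_range_iff Sum.inl_injective v).2 h1).mono (Set.image_subset_range _ _)
  -- extend them, inside `t`, to a maximal independent family `b`
  obtain ⟨b, hbt, hsb, hspan, hli⟩ := exists_linearIndepOn_extension hs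
    (Set.subset_union_left (t := Set.range (Sum.inr : σ → σ ⊕ σ)))
  have hinl : ∀ i, Sum.inl i ∈ b ↔ i ∈ U := by
    intro i
    constructor
    · intro h
      rcases hbt h with ⟨i', hi', hii'⟩ | ⟨k, hk⟩
      · rwa [Sum.inl_injective hii'] at hi'
      · exact absurd hk Sum.inr_ne_inl
    · intro h
      exact hsb ⟨i, h, rfl⟩
  -- `b` is a basis of `σ → K`, so it has `card σ` elements
  have hsp : (⊤ : Submodule K (σ → K)) ≤ Submodule.span K (Set.range fun x : b => v x) := by
    rw [← Set.image_eq_range, ← (Pi.basisFun K σ).span_eq, Submodule.span_le]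
    rintro _ ⟨k, rfl⟩
    rw [Pi.basisFun_apply]
    exact hspan ⟨Sum.inr k, Or.inr ⟨k, rfl⟩, rfl⟩
  have hcardb : Fintype.card b = Fintype.card σ := by
    rw [← Module.finrank_eq_card_basis (Module.Basis.mk hli.linearIndependent hsp),
      Module.finrank_fintype_fun_eq_card]
  have hsplit : Fintype.card b = U.card + Fintype.card {k : σ // Sum.inr k ∈ b} := by
    rw [Fintype.card_congr (Equiv.subtypeSum (p := (· ∈ b))), Fintype.card_sum,
      Fintype.card_of_subtype (p := fun a : σ => Sum.inl a ∈ b) U fun i => (hinl i).symm]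
  have hcard : Fintype.card {i // i ∉ U} = Fintype.card {k : σ // Sum.inr k ∈ b} := by
    rw [Fintype.card_of_subtype (p := fun i : σ => i ∉ U) Uᶜ fun i => Finset.mem_compl,
      Finset.card_compl]
    omega
  obtain ⟨β⟩ : Nonempty ({i // i ∉ U} ≃ {k : σ // Sum.inr k ∈ b}) :=
    ⟨Fintype.equivOfCardEq hcard⟩
  -- the completed matrix: column `i ∈ U` is column `i` of `B`, column `i ∉ U` is `e_{g i}`
  let g : σ → σ := fun i => if h : i ∈ U then i else (β ⟨i, h⟩ : σ)
  let q : Matrix σ σ K :=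
    Matrix.of fun j i => if i ∈ U then B j i else (Pi.single (g i) 1 : σ → K) j
  -- the index map `σ → b` enumerating the columns of `q` inside the family `v`
  let e : σ → σ ⊕ σ := fun i => if i ∈ U then Sum.inl i else Sum.inr (g i)
  have he : ∀ i, e i ∈ b := by
    intro i
    by_cases hi : i ∈ U
    · simp only [e, if_pos hi]
      exact (hinl i).2 hi
    · simp only [e, if_neg hi, g, dif_neg hi]
      exact (β ⟨i, hi⟩).2
  have hginj : ∀ i i', i ∉ U → i' ∉ U → g i = g i' → i = i' := by
    intro i i' hi hi' h
    simp only [g, dif_neg hi, dif_neg hi'] at h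
    exact congrArg Subtype.val (β.injective (Subtype.val_injective h))
  have heinj : Function.Injective e := by
    intro i i' h
    by_cases hi : i ∈ U <;> by_cases hi' : i' ∈ U
    · simpa [e, hi, hi'] using h
    · simp [e, hi, hi'] at h
    · simp [e, hi, hi'] at h
    · exact hginj i i' hi hi' (by simpa [e, hi, hi'] using h)
  have hcol : q.col = fun i => v (e i) := by
    funext i
    by_cases hi : i ∈ U
    · funext j
      simp [q, e, v, hi, Matrix.col_apply]
    · funext j
      simp [q, e, v, hi, Matrix.col_apply]
  have hqunit : IsUnit q := by
    rw [← Matrix.linearIndependent_cols_iff_isUnit, hcol]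
    exact hli.linearIndependent.comp (fun i => (⟨e i, he i⟩ : b)) fun i i' h =>
      heinj (congrArg Subtype.val h)
  exact ⟨q, g, hqunit, fun i hi j => by simp [q, hi], fun i hi j => by simp [q, hi]⟩

/-- **S4 (eigen-completion).** If the columns `i ∈ U` of `N = u · diag(w) · u⁻¹` are multiples of
the coordinate vectors `e_i`, then there is `p ∈ GL` whose columns `i ∈ U` are the `e_i` and which
conjugates the whole torus `s ↦ u · diag(s^w) · u⁻¹` to a coordinate torus `diag(s^{w'})`, with
`w'_i = N_ii` on `U` (complete `{u⁻¹ e_i}` by standard basis vectors inside each eigenspace of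
`diag(w)`). [folklore] -/
theorem stub_eigenCompletion : ∀ (σ : Type) [Fintype σ] [DecidableEq σ] (u : GL σ ℂ) (w : σ → ℕ)
    (U : Finset σ),
    (∀ i ∈ U, ∀ j, j ≠ i → ((u : Matrix σ σ ℂ) * Matrix.diagonal (fun k => (w k : ℂ)) *
        ((u⁻¹ : GL σ ℂ) : Matrix σ σ ℂ)) j i = 0) →
    ∃ (p : GL σ ℂ) (w' : σ → ℕ),
      (∀ i ∈ U, ∀ j, (p : Matrix σ σ ℂ) j i = if j = i then 1 else 0) ∧
      (∀ i ∈ U, (w' i : ℂ) = ((u : Matrix σ σ ℂ) * Matrix.diagonal (fun k => (w k : ℂ)) *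
        ((u⁻¹ : GL σ ℂ) : Matrix σ σ ℂ)) i i) ∧
      (∀ s : ℂ, ((p⁻¹ : GL σ ℂ) : Matrix σ σ ℂ) * (u : Matrix σ σ ℂ) *
          Matrix.diagonal (fun k => s ^ (w k)) * ((u⁻¹ : GL σ ℂ) : Matrix σ σ ℂ) * (p : Matrix σ σ ℂ) =
        Matrix.diagonal (fun k => s ^ (w' k))) := by
  intro σ _ _ u w U hcol
  set A : Matrix σ σ ℂ := (u : Matrix σ σ ℂ) with hA
  set B : Matrix σ σ ℂ := ((u⁻¹ : GL σ ℂ) : Matrix σ σ ℂ) with hB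
  set N : Matrix σ σ ℂ := A * Matrix.diagonal (fun k => (w k : ℂ)) * B with hN
  have hAB : A * B = 1 := u.mul_inv
  have hBA : B * A = 1 := u.inv_mul
  -- the eigen-relation: column `i ∈ U` of `B = u⁻¹` lives on the level set `w = N i i`
  have hlev : ∀ i ∈ U, ∀ j, B j i ≠ 0 → (w j : ℂ) = N i i := by
    intro i hi j hj
    have h1 : (Matrix.diagonal (fun k => (w k : ℂ)) * B) j i = (B * N) j i := by
      rw [hN, ← Matrix.mul_assoc, ← Matrix.mul_assoc, hBA, Matrix.one_mul]
    rw [Matrix.diagonal_mul, Matrix.mul_apply, Finset.sum_eq_single i, mul_comm] at h1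
    · exact mul_left_cancel₀ hj h1
    · intro k _ hk
      rw [hcol i hi k hk, mul_zero]
    · intro h
      exact absurd (Finset.mem_univ i) h
  -- the level `N i i` of `i ∈ U` is a natural number `v i`
  have hex : ∀ i, ∃ n : ℕ, i ∈ U → (n : ℂ) = N i i := by
    intro i
    by_cases hi : i ∈ U
    · have hcolB : ∃ j, B j i ≠ 0 := by
        by_contra h
        simp only [ne_eq, not_exists, not_not] at h
        have h1 : (1 : Matrix σ σ ℂ) i i = 0 := by
          rw [← hAB]
          simp [Matrix.mul_apply, h]
        simp at h1
      obtain ⟨j, hj⟩ := hcolB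
      exact ⟨w j, fun _ => hlev i hi j hj⟩
    · exact ⟨0, fun h => absurd h hi⟩
  choose v hv using hex
  -- complete the columns `i ∈ U` of `B` by coordinate vectors to an invertible `q`
  obtain ⟨q, g, hqU, hqB, hqg⟩ := exists_isUnit_extend_cols B (u⁻¹).isUnit U
  set w' : σ → ℕ := fun i => if i ∈ U then v i else w (g i) with hw'
  -- every column of `q` is supported on a level set of `w`, with level `w'`
  have hcomm : ∀ s : ℂ, Matrix.diagonal (fun k => s ^ (w k)) * q =
      q * Matrix.diagonal (fun k => s ^ (w' k)) := by
    intro s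
    ext j i
    rw [Matrix.diagonal_mul, Matrix.mul_diagonal]
    by_cases hi : i ∈ U
    · rw [hqB i hi]
      by_cases hji : B j i = 0
      · simp [hji]
      · have h1 : (w j : ℂ) = (v i : ℂ) := (hlev i hi j hji).trans (hv i hi).symm
        have h2 : w' i = w j := by
          simp only [hw', if_pos hi]
          exact_mod_cast h1.symm
        rw [h2, mul_comm]
    · rw [hqg i hi]
      by_cases hj : j = g i
      · subst hj
        simp [hw', hi, mul_comm]
      · simp [hj]
  have hBA' : ∀ X : Matrix σ σ ℂ, B * (A * X) = X := fun X => by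
    rw [← Matrix.mul_assoc, hBA, Matrix.one_mul]
  refine ⟨u * hqU.unit, w', ?_, ?_, ?_⟩
  · -- the `U`-columns of `p = u q` are `u u⁻¹ e_i = e_i`
    intro i hi j
    rw [Units.val_mul, hqU.unit_spec]
    have h1 : (A * q) j i = (A * B) j i := by
      simp only [Matrix.mul_apply, hqB i hi]
    rw [h1, hAB, Matrix.one_apply]
  · intro i hi
    simp only [hw', if_pos hi]
    exact hv i hi
  · intro s
    rw [mul_inv_rev, Units.val_mul, Units.val_mul, hqU.unit_spec, ← hA, ← hB]
    simp only [Matrix.mul_assoc, hBA']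
    rw [hcomm s, ← Matrix.mul_assoc, hqU.val_inv_mul, Matrix.one_mul]

end Summit.ValiantsHypothesis.ValiantsHypothesis.Theorems.BorderApolarityToricWitnessObstructionQP
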